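import Summits.ResolutionOfSingularities.ResolutionOfSingularities.Theorems.FrobeniusClosingSteerJacobianLengthFlat
import Summits.ResolutionOfSingularities.ResolutionOfSingularities.Theorems.FrobeniusClosingSteerJacobianLengthTransport
import Summits.ResolutionOfSingularities.ResolutionOfSingularities.Theorems.FrobeniusClosingSteerPowerSeriesFiniteExtension
import Summits.ResolutionOfSingularities.ResolutionOfSingularities.Theorems.FrobeniusClosingSteerPowerSeriesDerivationExtend
import HarnessLib

/-!
# Crux `Steer` (stmt-ResolutionOfSingularities-16345), chain W4.1, K3ᴳ / ℓ-COMPARISON plan B file (3): the comparison GIVEN COMMUTING COHEN FRAMES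

OURS (campaign `res-hironaka`, rung L ★L-G4, slot W4.1; seat res-L0-w41-stub-2 g6; `K3G/JacobianLengthEtale-PLAN.md` f671a211d1dd908a, plan B step 3).
Theses-free, definition-free. For a ring map `ψ : T → T′` READ IN FRAMES as `map λ : κ⟦X⟧ → κ′⟦X⟧` (`φ′ ∘ ψ = map λ ∘ φ`, `φ : T ≃ κ⟦X⟧`, `φ′ : T′ ≃ κ′⟦X⟧`),
with `κ′/κ` FINITE (a basis `b`) and a finite `p`-basis dual frame of `κ` whose derivations extend along `λ` (K-GG5 (b)): for every `t ∈ T`,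
`ℓ_{T′}(T′ ⧸ (Dv (ψ t))_{Dv ∈ Der_ℤ T′}) ≤ ℓ_{T}(T ⧸ (Dv t)_{Dv ∈ Der_ℤ T})` — the algebraic core p565302 over (2a) `PowerSeriesFiniteExt.flat` /
`map_maximalIdeal_eq`, (2b) `PowerSeriesDerivExt.exists_derivation_map_eq`, transported by (E) `JacobianLength.length_quotient_jacobian_eq_of_ringEquiv`.
What is left for `…JacobianLengthEtale` (SPEC 2002aab6dc189340) is ONLY the frame square for the completed étale-local map `Ŝ → Ŝ′` (plan B step 1:
`NestedFrames` with K-GG2 (a) in place of rationality). [cite: Matsumura1987, Thm. 30.6] [folklore]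

* `JacobianLength.length_quotient_span_derivation_le_of_frames`.
-/

noncomputable section

set_option linter.dupNamespace false

open IsLocalRing MvPowerSeries
open Literature.RingTheory.Derivation Literature.FieldTheory.Separability Literature.AlgebraicGeometry.Resolution
open Summit.ResolutionOfSingularities.ResolutionOfSingularities.Theorems.SwitchingDichotomy

namespace Summit.ResolutionOfSingularities.ResolutionOfSingularities.Theorems.SwitchingDichotomy.JacobianLength

/-- The `Algebra ℤ` instance on a ring is unique; transport of a derivation between two such instances (the `MvPowerSeries.instAlgebra` /
`Ring.toIntAlgebra` diamond). -/
theorem exists_derivation_coe_eq {R : Type} [CommRing R] (i₁ i₂ : Algebra ℤ R) (D : @Derivation ℤ R R _ _ _ i₁ _ _) :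
    ∃ D₂ : @Derivation ℤ R R _ _ _ i₂ _ _, (⇑D₂ : R → R) = ⇑D := by
  obtain rfl : i₁ = i₂ := Algebra.algebra_ext _ _ fun r => (eq_intCast _ r).trans (eq_intCast _ r).symm
  exact ⟨D, rfl⟩

/-- The same uniqueness at the level of the absolute Jacobian ideals `(Dv a)_{Dv}`. -/
theorem span_range_derivation_eq {R : Type} [CommRing R] (i₁ i₂ : Algebra ℤ R) (a : R) :
    Ideal.span (Set.range fun D : @Derivation ℤ R R _ _ _ i₁ _ _ => D a) = Ideal.span (Set.range fun D : @Derivation ℤ R R _ _ _ i₂ _ _ => D a) := by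
  obtain rfl : i₁ = i₂ := Algebra.algebra_ext _ _ fun r => (eq_intCast _ r).trans (eq_intCast _ r).symm
  rfl

/-- **ℓ-comparison given commuting Cohen frames.** See the module docstring. [cite: Matsumura1987, Thm. 30.6] [folklore] -/
theorem length_quotient_span_derivation_le_of_frames (p : ℕ) [Fact p.Prime]
    {T T' : Type} [CommRing T] [CommRing T'] (ψ : T →+* T')
    {κ κ' : Type} [Field κ] [Field κ'] [CharP κ p] [Algebra κ κ'] {ι : Type} [Fintype ι] (b : Module.Basis ι κ κ')
    {n : ℕ} (φ : T ≃+* MvPowerSeries (Fin n) κ) (φ' : T' ≃+* MvPowerSeries (Fin n) κ')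
    (hsq : ∀ t, φ' (ψ t) = MvPowerSeries.map (algebraMap κ κ') (φ t))
    {r : ℕ} (γ : Fin r → κ) (D : Fin r → Derivation ℤ κ κ) (hdual : ∀ l l', D l (γ l') = if l' = l then 1 else 0)
    (hgen : pAdjoin p (Set.range γ) = ⊤)
    (D' : Fin r → Derivation ℤ κ' κ') (hD' : ∀ l a, D' l (algebraMap κ κ' a) = algebraMap κ κ' (D l a)) (t : T) :
    Module.length T' (T' ⧸ Ideal.span (Set.range fun Dv : Derivation ℤ T' T' => Dv (ψ t))) ≤
      Module.length T (T ⧸ Ideal.span (Set.range fun Dv : Derivation ℤ T T => Dv t)) := by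
  classical
  -- instances on `κ′⟦X⟧ / κ⟦X⟧`
  haveI : Module.Flat (MvPowerSeries (Fin n) κ) (MvPowerSeries (Fin n) κ') := PowerSeriesFiniteExt.flat b
  haveI : IsLocalHom (algebraMap (MvPowerSeries (Fin n) κ) (MvPowerSeries (Fin n) κ')) := MvPowerSeries.map.isLocalHom _
  have hunr := PowerSeriesFiniteExt.map_maximalIdeal_eq (σ := Fin n) b
  -- the core lemma in frames, at `a := φ t`
  have hcore := length_quotient_span_derivation_le_of_flat_unramified (R := MvPowerSeries (Fin n) κ) (R' := MvPowerSeries (Fin n) κ')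
    hunr (φ t) (fun Dg => by
      obtain ⟨Δ, hΔ⟩ := exists_derivation_coe_eq _ (MvPowerSeries.instAlgebra) Dg
      obtain ⟨Δ', hΔ'⟩ := PowerSeriesDerivExt.exists_derivation_map_eq p (algebraMap κ κ') γ D hdual hgen D' hD' Δ
      obtain ⟨Dg', hDg'⟩ := exists_derivation_coe_eq _ (Ring.toIntAlgebra _) Δ'
      refine ⟨Dg', ?_⟩
      rw [MvPowerSeries.algebraMap_apply'', show Dg' (MvPowerSeries.map (algebraMap κ κ') (φ t)) = Δ' (MvPowerSeries.map (algebraMap κ κ') (φ t))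
        from congrFun hDg' _, hΔ', show Dg (φ t) = Δ (φ t) from (congrFun hΔ _).symm, MvPowerSeries.algebraMap_apply''])
  -- transport both sides along the frames
  have hT := length_quotient_jacobian_eq_of_ringEquiv φ t
  have hT' := length_quotient_jacobian_eq_of_ringEquiv φ' (ψ t)
  rw [← hT, ← hT']
  have hψ : φ' (ψ t) = algebraMap (MvPowerSeries (Fin n) κ) (MvPowerSeries (Fin n) κ') (φ t) := by
    rw [MvPowerSeries.algebraMap_apply'', hsq]
  rw [hψ]
  refine le_of_eq_of_le ?_ (le_of_le_of_eq hcore ?_)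
  · exact congrArg (fun J => Module.length _ (_ ⧸ J)) (span_range_derivation_eq _ _ _)
  · exact congrArg (fun J => Module.length _ (_ ⧸ J)) (span_range_derivation_eq _ _ _)

end Summit.ResolutionOfSingularities.ResolutionOfSingularities.Theorems.SwitchingDichotomy.JacobianLength

end
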